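import Literature.NumberTheory.QuadraticFields.ThreeTorsionMean
import Literature.NumberTheory.QuadraticFields.ThreeTorsionMeanSquarefreeCount
import Mathlib.Data.Nat.Factorization.Basic
import HarnessLib

/-!
# Taniguchi–Thorne, Lemma 21: the local factors

Identification of the local factors `e_p = 1 - 𝟙_{gcd(L,p²) ∣ c} gcd(L,p²)/p²` of the squarefree
count in a residue class (`abs_card_squarefree_modEq_sub_le'`,
`ThreeTorsionMeanSquarefreeCount.lean`) with the printed local factors `e(a, pᵏ)` of
Taniguchi–Thorne 2013, Lemma 21 (`ttLocalFactorOdd`, `ThreeTorsionMean.lean`), and their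
invariance under the substitutions `D = 4d`, `D = 8k` of the 2-adic trichotomy. All PROVED.

* `gcd_prime_sq_eq` — `gcd(m, p²) = p` if `p ∥ m`, `= p²` if `p² ∣ m`;
* `localFactor_eq_ttLocalFactorOdd` — `e_p(m, a) = e(a, p^{v_p(m)})` for every prime `p ∣ m`;
* `localFactor_two_eq_one` — `e_2(m, a) = 1` for `4 ∣ m`, `a` odd;
* `density_eq_tt` — for `4 ∣ m ≠ 0` and `a` odd:
  `(6/π²) Π_{p ∣ m} e_p (1 - p⁻²)⁻¹ = (8/π²) Π_{p ∣ m, p > 2} e(a, p^{v_p m}) (1 - p⁻²)⁻¹`;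
* `primeFactors_div_eq`, `factorization_div_eq_of_odd`, `ttLocalFactorOdd_div_eq`,
  `prod_tt_div_eq` — invariance of the odd local data under `(m, a) ↦ (m/s, a/s)`, `s = 4, 8`.

## References
* T. Taniguchi, F. Thorne, *Secondary terms in counting functions for cubic fields*, Duke Math. J.
  162 (2013), Lemma 21 [TaniguchiThorne2013].
-/

noncomputable section

open Finset

namespace Literature.NumberTheory.QuadraticFields

/-! ### `gcd(m, p²)` and the local factor at a prime `p ∣ m` -/

/-- For a prime `p ∣ m ≠ 0`: `gcd(m, p²) = p` if `v_p(m) = 1` and `= p²` otherwise. [folklore] -/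
theorem gcd_prime_sq_eq {m p : ℕ} (hp : p.Prime) (hm : m ≠ 0) (hpm : p ∣ m) :
    Nat.gcd m (p ^ 2) = if m.factorization p = 1 then p else p ^ 2 := by
  have hk : 1 ≤ m.factorization p := (hp.dvd_iff_one_le_factorization hm).1 hpm
  split_ifs with h1
  · have hp2 : ¬ p ^ 2 ∣ m := by
      rw [hp.pow_dvd_iff_le_factorization hm]; omega
    have hdvd : Nat.gcd m (p ^ 2) ∣ p ^ 2 := Nat.gcd_dvd_right _ _
    obtain ⟨j, hj, hgj⟩ := (Nat.dvd_prime_pow hp).1 hdvd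
    have hpg : p ∣ Nat.gcd m (p ^ 2) := Nat.dvd_gcd hpm (dvd_pow_self p two_ne_zero)
    have hgm : Nat.gcd m (p ^ 2) ∣ m := Nat.gcd_dvd_left _ _
    rw [hgj] at hpg hgm ⊢
    have hj0 : j ≠ 0 := by
      rintro rfl
      rw [pow_zero, Nat.dvd_one] at hpg
      exact hp.one_lt.ne' hpg
    have hj2 : j ≠ 2 := by
      rintro rfl
      exact hp2 hgm
    interval_cases j
    · exact absurd rfl hj0
    · exact pow_one p
    · exact absurd rfl hj2
  · have h2 : 2 ≤ m.factorization p := by omega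
    exact Nat.gcd_eq_right ((hp.pow_dvd_iff_le_factorization hm).2 h2)

/-- **The local factor at a prime `p ∣ m` is Taniguchi–Thorne's `e(a, p^{v_p(m)})`**:
`1 - 𝟙_{gcd(m,p²) ∣ a} gcd(m,p²)/p² = ttLocalFactorOdd p (v_p m) a`. [cite: TaniguchiThorne2013, Lemma 21] -/
theorem localFactor_eq_ttLocalFactorOdd {m p : ℕ} (hp : p.Prime) (hm : m ≠ 0) (hpm : p ∣ m)
    (a : ℤ) :
    (1 - (if ((Nat.gcd m (p ^ 2) : ℕ) : ℤ) ∣ a then ((Nat.gcd m (p ^ 2) : ℕ) : ℝ) / (p : ℝ) ^ 2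
      else 0)) = ttLocalFactorOdd p (m.factorization p) a := by
  have hk : 1 ≤ m.factorization p := (hp.dvd_iff_one_le_factorization hm).1 hpm
  have hp0 : (p : ℝ) ≠ 0 := by exact_mod_cast hp.ne_zero
  rw [gcd_prime_sq_eq hp hm hpm, ttLocalFactorOdd]
  by_cases h1 : m.factorization p = 1
  · rw [if_pos h1]
    by_cases hpa : (p : ℤ) ∣ a
    · rw [if_pos hpa, if_neg (not_not.2 hpa), if_neg (fun h => absurd h.1 (by omega)), if_pos h1]
      rw [pow_two, div_mul_eq_div_div, div_self hp0]
    · rw [if_neg hpa, if_pos hpa, sub_zero]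
  · rw [if_neg h1]
    have h2 : 2 ≤ m.factorization p := by omega
    by_cases hpa2 : (p : ℤ) ^ 2 ∣ a
    · have hpa : (p : ℤ) ∣ a := (dvd_pow_self (p : ℤ) two_ne_zero).trans hpa2
      rw [if_pos (by exact_mod_cast hpa2), if_neg (not_not.2 hpa), if_neg (fun h => h.2 hpa2),
        if_neg h1]
      push_cast
      rw [div_self (pow_ne_zero 2 hp0), sub_self]
    · rw [if_neg (by exact_mod_cast hpa2)]
      by_cases hpa : (p : ℤ) ∣ a
      · rw [if_neg (not_not.2 hpa), if_pos ⟨h2, hpa2⟩, sub_zero]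
      · rw [if_pos hpa, sub_zero]

/-- At `p = 2` with `4 ∣ m` and `a` odd the local factor is `1` (`gcd(m, 4) = 4 ∤ a`). [folklore] -/
theorem localFactor_two_eq_one {m : ℕ} (hm : 4 ∣ m) {a : ℤ} (ha : a % 2 = 1) :
    (1 - (if ((Nat.gcd m (2 ^ 2) : ℕ) : ℤ) ∣ a then
      ((Nat.gcd m (2 ^ 2) : ℕ) : ℝ) / (((2 : ℕ) : ℝ)) ^ 2 else 0)) = 1 := by
  have hg : Nat.gcd m (2 ^ 2) = 4 := Nat.gcd_eq_right (by simpa using hm)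
  rw [hg, if_neg, sub_zero]
  push_cast
  omega

/-- **The density in Taniguchi–Thorne's form**: for `4 ∣ m ≠ 0` and `a` odd,
`(6/π²) Π_{p ∣ m} e_p (1 - p⁻²)⁻¹ = (8/π²) Π_{p ∣ m, p ≠ 2} e(a, p^{v_p m}) (1 - p⁻²)⁻¹`.
[cite: TaniguchiThorne2013, Lemma 21] -/
theorem density_eq_tt {m : ℕ} (hm0 : m ≠ 0) (hm : 4 ∣ m) {a : ℤ} (ha : a % 2 = 1) :
    6 / Real.pi ^ 2 * ∏ p ∈ m.primeFactors,
        (1 - (if ((Nat.gcd m (p ^ 2) : ℕ) : ℤ) ∣ a then ((Nat.gcd m (p ^ 2) : ℕ) : ℝ) / (p : ℝ) ^ 2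
          else 0)) * (1 - 1 / (p : ℝ) ^ 2)⁻¹ =
      8 / Real.pi ^ 2 * ∏ p ∈ m.primeFactors.erase 2,
        ttLocalFactorOdd p (m.factorization p) a * (1 - 1 / (p : ℝ) ^ 2)⁻¹ := by
  have h2 : 2 ∈ m.primeFactors :=
    Nat.mem_primeFactors.2 ⟨Nat.prime_two, (dvd_trans ⟨2, by norm_num⟩ hm), hm0⟩
  rw [← Finset.mul_prod_erase _ _ h2, localFactor_two_eq_one hm ha]
  have hrest : ∏ p ∈ m.primeFactors.erase 2,
      (1 - (if ((Nat.gcd m (p ^ 2) : ℕ) : ℤ) ∣ a then ((Nat.gcd m (p ^ 2) : ℕ) : ℝ) / (p : ℝ) ^ 2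
        else 0)) * (1 - 1 / (p : ℝ) ^ 2)⁻¹ =
      ∏ p ∈ m.primeFactors.erase 2, ttLocalFactorOdd p (m.factorization p) a *
        (1 - 1 / (p : ℝ) ^ 2)⁻¹ := by
    refine Finset.prod_congr rfl fun p hp => ?_
    have hp' := Finset.mem_of_mem_erase hp
    rw [localFactor_eq_ttLocalFactorOdd (Nat.prime_of_mem_primeFactors hp') hm0
      (Nat.dvd_of_mem_primeFactors hp') a]
  rw [hrest]
  norm_num
  ring

/-! ### Invariance under `(m, a) ↦ (m/s, a/s)`, `s = 4, 8` -/

/-- For `s ∣ m` with `m/s` even and `s` a power of `2`: `(m/s)` and `m` have the same prime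
factors. [folklore] -/
theorem primeFactors_div_eq {m s j : ℕ} (hs : s = 2 ^ j) (hsm : 2 * s ∣ m) (hm : m ≠ 0) :
    (m / s).primeFactors = m.primeFactors := by
  have hs0 : 0 < s := by rw [hs]; positivity
  have hsm' : s ∣ m := (dvd_mul_left s 2).trans hsm
  have hms : m = s * (m / s) := (Nat.mul_div_cancel' hsm').symm
  have hq0 : m / s ≠ 0 := fun h => hm (by rw [hms, h, mul_zero])
  ext p
  simp only [Nat.mem_primeFactors, ne_eq, hq0, not_false_eq_true, and_true, hm]
  constructor
  · rintro ⟨hp, hd⟩; exact ⟨hp, hd.trans (Nat.div_dvd_of_dvd hsm')⟩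
  · rintro ⟨hp, hd⟩
    refine ⟨hp, ?_⟩
    rcases eq_or_ne p 2 with rfl | hp2
    · obtain ⟨t, ht⟩ := hsm
      refine ⟨t, ?_⟩
      rw [ht, show 2 * s * t = s * (2 * t) by ring, Nat.mul_div_cancel_left _ hs0]
    · have hcop : Nat.Coprime p s := by
        rw [hs]; exact Nat.Coprime.pow_right j ((Nat.coprime_primes hp Nat.prime_two).2 hp2)
      rw [hms] at hd
      exact hcop.dvd_of_dvd_mul_left hd

/-- For `p ≠ 2` and `s = 2ʲ ∣ m`: `v_p(m/s) = v_p(m)`. [folklore] -/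
theorem factorization_div_eq_of_odd {m s j p : ℕ} (hs : s = 2 ^ j) (hsm : s ∣ m)
    (hp2 : p ≠ 2) : (m / s).factorization p = m.factorization p := by
  rw [Nat.factorization_div hsm, Finsupp.tsub_apply, hs, Nat.Prime.factorization_pow Nat.prime_two,
    Finsupp.single_apply, if_neg (Ne.symm hp2)]
  simp

/-- For odd `p`, `s = 2ʲ` and `s ∣ a`: `e(a/s, pᵏ) = e(a, pᵏ)` (divisibility of `a` by `p`, `p²` is
unchanged). [folklore] -/
theorem ttLocalFactorOdd_div_eq {s j p k : ℕ} (hs : s = 2 ^ j) (hp : p.Prime) (hp2 : p ≠ 2)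
    {a : ℤ} (hsa : (s : ℤ) ∣ a) : ttLocalFactorOdd p k (a / s) = ttLocalFactorOdd p k a := by
  obtain ⟨a', rfl⟩ := hsa
  have hs0 : (s : ℤ) ≠ 0 := by rw [hs]; positivity
  rw [Int.mul_ediv_cancel_left _ hs0]
  have hcop : ∀ i : ℕ, IsCoprime ((p : ℤ) ^ i) (s : ℤ) := by
    intro i
    have h : Nat.Coprime (p ^ i) s := by
      rw [hs]; exact Nat.Coprime.pow _ _ ((Nat.coprime_primes hp Nat.prime_two).2 hp2)
    have := Nat.isCoprime_iff_coprime.2 h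
    exact_mod_cast this
  have hiff : ∀ i : ℕ, (p : ℤ) ^ i ∣ (s : ℤ) * a' ↔ (p : ℤ) ^ i ∣ a' := fun i =>
    ⟨fun h => (hcop i).dvd_of_dvd_mul_left h, fun h => h.mul_left _⟩
  have h1 := hiff 1
  rw [pow_one] at h1
  simp only [ttLocalFactorOdd, h1, hiff 2]

/-- The odd part of Taniguchi–Thorne's density is unchanged under `(m, a) ↦ (m/s, a/s)` for
`s = 2ʲ` with `2s ∣ m`, `s ∣ a`. [folklore] -/
theorem prod_tt_div_eq {m s j : ℕ} (hs : s = 2 ^ j) (hsm : 2 * s ∣ m) (hm : m ≠ 0) {a : ℤ}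
    (hsa : (s : ℤ) ∣ a) :
    ∏ p ∈ (m / s).primeFactors.erase 2,
        ttLocalFactorOdd p ((m / s).factorization p) (a / s) * (1 - 1 / (p : ℝ) ^ 2)⁻¹ =
      ∏ p ∈ m.primeFactors.erase 2,
        ttLocalFactorOdd p (m.factorization p) a * (1 - 1 / (p : ℝ) ^ 2)⁻¹ := by
  rw [primeFactors_div_eq hs hsm hm]
  refine Finset.prod_congr rfl fun p hp => ?_
  have hp2 : p ≠ 2 := Finset.ne_of_mem_erase hp
  have hpP : p.Prime := Nat.prime_of_mem_primeFactors (Finset.mem_of_mem_erase hp)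
  rw [factorization_div_eq_of_odd hs ((dvd_mul_left s 2).trans hsm) hp2,
    ttLocalFactorOdd_div_eq hs hpP hp2 hsa]

end Literature.NumberTheory.QuadraticFields

end
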